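import Summits.ResolutionOfSingularities.ResolutionOfSingularities.Theorems.EquisingularLiftEquisingularLiftNatSubmaxLinePrime
import Summits.ResolutionOfSingularities.ResolutionOfSingularities.Theorems.EquisingularLiftEquisingularLiftNatSubmaxLinAlgebraN
import HarnessLib

/-!
# [OURS · EL♮] HYPERSURFACES IN `ℙ^{r+2}` WITH THE CODIMENSION-2 LINEAR SUBSPACE `V(x_{r+1}, x_{r+2})` OF SUBMAXIMAL MULTIPLICITY — THE CHARTS:
# `F = Σ_{j ≤ r} x_j·A_j(x_{r+1},x_{r+2}) + C(x_{r+1},x_{r+2})`, its dehomogenisations, strict transforms and the regularity of all chart rings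
# (crux `Theses.EquisingularLift.EquisingularLiftNat`, stmt-ResolutionOfSingularities-20038; `r = 1`: EL♮(3), stmt-…-20148)

[OURS · leafhand-res-equisingularlift-7 g0, 2026-08-31; cell `pub/decomp-res`] AI-produced, weaker than expert review; NOT a statement of any
manuscript; nothing here proves resolution of singularities in positive characteristic.  DEF-FREE helper; no `sorry`; standard axioms; ZERO named
hypotheses.  The all-dimension version of `…NatSubmaxLine` (`r = 1`): surviving variables `x_j` (`j : Fin (r+1)`, index `j.castSucc.castSucc`),
killed variables `x_{r+1+b}` (`b : Fin 2`, index `⟨r+1+b, _⟩`), `A_j` binary forms of degree `d + 1`, `C` a binary form of degree `d + 2`; the chart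
coordinates of `D₊(x_c)` are indexed by `Fin (r+1+1)`, the centre coordinates being `y_{r}, y_{r+1}`.

* index bookkeeping (`succAbove`), `dehomogenize_F` (all charts at once);
* off the centre (`c = x_{r+1+b}`): `isRegularRing_quotient_dehomogenize_killed` — `K[y]/(F(x_c := 1))` regular (engine `isRegularRing_quotient_linN`);
* on the centre (`c = x_i`, `i ≤ r`): `subst_dehomogenize_surv` (strict transform `y_{r+a}^{d+1} · f′`) — hypotheses for regularity / non-divisibility
  are discharged in the companion `…NatSubmaxLinN`.
-/

set_option linter.dupNamespace false -- mandated namespace `Summit.<Summit>.<Problem>` of this single-conjunct summit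

noncomputable section

open MvPolynomial
open Literature.AlgebraicGeometry.Resolution
open Literature.AlgebraicGeometry.Motives

namespace Summit.ResolutionOfSingularities.ResolutionOfSingularities.Cruxes.EquisingularLiftNat.Sections

namespace SubmaxLinN

variable (K : Type) [Field K] {r : ℕ}

/-! ## Index bookkeeping in `Fin (r + 1 + 1 + 1)` (ambient) and `Fin (r + 1 + 1)` (charts) -/

/-- Every variable is surviving (`x_j`, `j ≤ r`) or killed (`x_{r+1+b}`). [folklore] -/
theorem surv_or_killed (i : Fin (r + 1 + 1 + 1)) :
    (∃ j : Fin (r + 1), i = j.castSucc.castSucc) ∨ (∃ b : Fin 2, i = ⟨r + 1 + b, by omega⟩) := by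
  by_cases hi : (i : ℕ) < r + 1
  · exact Or.inl ⟨⟨i, hi⟩, Fin.ext (by simp)⟩
  · refine Or.inr ⟨⟨(i : ℕ) - (r + 1), by omega⟩, Fin.ext ?_⟩
    simp
    omega

/-- `x_{r+1+b}` is not a surviving variable. [folklore] -/
theorem killed_not_mem_range (b : Fin 2) :
    (⟨r + 1 + b, by omega⟩ : Fin (r + 1 + 1 + 1)) ∉ Set.range (fun j : Fin (r + 1) => j.castSucc.castSucc) := by
  rintro ⟨j, hj⟩
  have h := congrArg Fin.val hj
  simp at h
  omega

/-- A variable that is not surviving is killed. [folklore] -/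
theorem exists_eq_killed {a : Fin (r + 1 + 1 + 1)} (ha : a ∉ Set.range (fun j : Fin (r + 1) => j.castSucc.castSucc)) :
    ∃ b : Fin 2, a = ⟨r + 1 + b, by omega⟩ := by
  rcases surv_or_killed (r := r) a with ⟨j, rfl⟩ | h
  · exact absurd ⟨j, rfl⟩ ha
  · exact h

/-- On a centre chart `c = x_i`: the killed variable `x_{r+1+b}` is the chart coordinate `y_{r+b}`. [folklore] -/
theorem succAbove_surv_cen (i : Fin (r + 1)) (b : Fin 2) :
    (i.castSucc.castSucc : Fin (r + 1 + 1 + 1)).succAbove (⟨r + b, by omega⟩ : Fin (r + 1 + 1)) = ⟨r + 1 + b, by omega⟩ := by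
  rw [Fin.succAbove_of_le_castSucc]
  · ext
    simp
    omega
  · rw [Fin.le_def]
    simp
    omega

/-- On a centre chart `c = x_i`: a surviving variable `x_j = c.succAbove l` has `l < r`. [folklore] -/
theorem val_lt_of_succAbove_surv (i j : Fin (r + 1)) (l : Fin (r + 1 + 1))
    (h : (i.castSucc.castSucc : Fin (r + 1 + 1 + 1)).succAbove l = j.castSucc.castSucc) : (l : ℕ) < r := by
  have hv := congrArg Fin.val h
  by_cases hl : Fin.castSucc l < (i.castSucc.castSucc : Fin (r + 1 + 1 + 1))
  · rw [Fin.succAbove_of_castSucc_lt _ _ hl] at hv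
    rw [Fin.lt_def] at hl
    simp at hl hv
    have := j.2
    omega
  · rw [not_lt] at hl
    rw [Fin.succAbove_of_le_castSucc _ _ hl] at hv
    simp at hv
    have := j.2
    omega

/-- Off the centre, `c = x_{r+1+b}`: the surviving `x_j` is the chart coordinate `y_j`. [folklore] -/
theorem succAbove_killed_castSucc (b : Fin 2) (j : Fin (r + 1)) :
    (⟨r + 1 + b, by omega⟩ : Fin (r + 1 + 1 + 1)).succAbove (Fin.castSucc j) = j.castSucc.castSucc := by
  rw [Fin.succAbove_of_castSucc_lt]
  rw [Fin.lt_def]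
  simp
  omega

/-- Off the centre, `c = x_{r+1+b}`: the other killed variable is the chart coordinate `y_{r+1}`. [folklore] -/
theorem succAbove_killed_last (b b' : Fin 2) (hbb' : b ≠ b') :
    (⟨r + 1 + b, by omega⟩ : Fin (r + 1 + 1 + 1)).succAbove (Fin.last (r + 1)) = ⟨r + 1 + b', by omega⟩ := by
  fin_cases b <;> fin_cases b'
  · exact absurd rfl hbb'
  · rw [Fin.succAbove_of_le_castSucc]
    · ext
      simp
    · rw [Fin.le_def]
      simp
  · rw [Fin.succAbove_of_castSucc_lt]
    · ext
      simp
    · rw [Fin.lt_def]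
      simp
  · exact absurd rfl hbb'

/-- Hu's substitution on a binary form placed in the centre variables: `G(g) ↦ u^m · G(g')` when `g_b ↦ u·g'_b`. [cite: Hu2025, §5 Prop. 5.3] -/
theorem subst_aevalN {N : ℕ} (cen : Set (Fin N)) (i₀ : Fin N) (g g' : Fin 2 → MvPolynomial (Fin N) K) (u : MvPolynomial (Fin N) K)
    (hg : ∀ b, coordBlowupSubst K cen i₀ (g b) = u * g' b) (G : MvPolynomial (Fin 2) K) {m : ℕ} (hG : G.IsHomogeneous m) :
    coordBlowupSubst K cen i₀ (aeval g G) = u ^ m * aeval g' G := by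
  rw [comp_aeval_apply]
  have h : (fun b => coordBlowupSubst K cen i₀ (g b)) = u • g' := by
    funext b
    rw [hg b]
    rfl
  rw [h, SubmaxLine.aeval_smul_of_isHomogeneous K hG]

/-! ## The dehomogenisations of `F = Σ_j x_j·A_j + C` -/

/-- **Dehomogenising a binary form placed in the killed variables**: `G(x_{r+1}, x_{r+2})(x_c := 1) = G(g)`, `g_b = x_{r+1+b}(x_c := 1)`. [folklore] -/
theorem dehomogenize_rename_killed (c : Fin (r + 1 + 1 + 1)) (G : MvPolynomial (Fin 2) K) :
    ProjectiveSpace.dehomogenize K c (rename (fun b : Fin 2 => (⟨r + 1 + b, by omega⟩ : Fin (r + 1 + 1 + 1))) G) =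
      aeval (fun b : Fin 2 => ProjectiveSpace.dehomogenize K c
        (X (⟨r + 1 + b, by omega⟩ : Fin (r + 1 + 1 + 1)) : MvPolynomial (Fin (r + 1 + 1 + 1)) K)) G := by
  have h : (ProjectiveSpace.dehomogenize K c).comp (rename (fun b : Fin 2 => (⟨r + 1 + b, by omega⟩ : Fin (r + 1 + 1 + 1))) :
      MvPolynomial (Fin 2) K →ₐ[K] MvPolynomial (Fin (r + 1 + 1 + 1)) K) =
      aeval (fun b : Fin 2 => ProjectiveSpace.dehomogenize K c
        (X (⟨r + 1 + b, by omega⟩ : Fin (r + 1 + 1 + 1)) : MvPolynomial (Fin (r + 1 + 1 + 1)) K)) := by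
    apply MvPolynomial.algHom_ext
    intro b
    rw [AlgHom.comp_apply, rename_X, aeval_X]
  exact DFunLike.congr_fun h G

section Family

variable {d : ℕ} (A : Fin (r + 1) → MvPolynomial (Fin 2) K) (C : MvPolynomial (Fin 2) K)
  (hA : ∀ j, (A j).IsHomogeneous (d + 1)) (hC : C.IsHomogeneous (d + 2)) (F : MvPolynomial (Fin (r + 1 + 1 + 1)) K)
  (hF : F = ∑ j : Fin (r + 1), (X (j.castSucc.castSucc) : MvPolynomial (Fin (r + 1 + 1 + 1)) K) *
      rename (fun b : Fin 2 => (⟨r + 1 + b, by omega⟩ : Fin (r + 1 + 1 + 1))) (A j) +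
    rename (fun b : Fin 2 => (⟨r + 1 + b, by omega⟩ : Fin (r + 1 + 1 + 1))) C)

include hF in
/-- **All charts at once**: `F(x_c := 1) = Σ_j u_j · A_j(g) + C(g)` with `u_j = x_j(x_c := 1)`, `g_b = x_{r+1+b}(x_c := 1)`. [folklore] -/
theorem dehomogenize_F (c : Fin (r + 1 + 1 + 1)) :
    ProjectiveSpace.dehomogenize K c F =
      ∑ j : Fin (r + 1), ProjectiveSpace.dehomogenize K c (X (j.castSucc.castSucc) : MvPolynomial (Fin (r + 1 + 1 + 1)) K) *
        aeval (fun b : Fin 2 => ProjectiveSpace.dehomogenize K c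
          (X (⟨r + 1 + b, by omega⟩ : Fin (r + 1 + 1 + 1)) : MvPolynomial (Fin (r + 1 + 1 + 1)) K)) (A j) +
      aeval (fun b : Fin 2 => ProjectiveSpace.dehomogenize K c
        (X (⟨r + 1 + b, by omega⟩ : Fin (r + 1 + 1 + 1)) : MvPolynomial (Fin (r + 1 + 1 + 1)) K)) C := by
  rw [hF, map_add, map_sum]
  congr 1
  · refine Finset.sum_congr rfl fun j _ => ?_
    rw [map_mul, dehomogenize_rename_killed]
  · exact dehomogenize_rename_killed K c C

/-! ## Off the centre: the chart rings `K[y]/(F(x_{r+1+b} := 1))` are regular -/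

include hF in
/-- **Off-centre chart equation is regular**: for `c = x_{r+1+b}`, `F(x_c := 1) = Σ_j y_j · A_j(g) + C(g)` with `g_b = 1`, `g_{b'} = y_{r+1}`, regular
by the engine as soon as `(A_j)_j, C` have no common zero on `ℙ¹` (`K = K̄`). [cite: StacksProject, Tag 07PF] -/
theorem isRegularRing_quotient_dehomogenize_killed [IsAlgClosed K]
    (hnc : ∀ v : Fin 2 → K, v ≠ 0 → ¬ ((∀ j, MvPolynomial.eval v (A j) = 0) ∧ MvPolynomial.eval v C = 0)) (b : Fin 2) :
    IsRegularRing (MvPolynomial (Fin (r + 1 + 1)) K ⧸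
      Ideal.span {ProjectiveSpace.dehomogenize K (⟨r + 1 + b, by omega⟩ : Fin (r + 1 + 1 + 1)) F}) := by
  classical
  set g : Fin 2 → MvPolynomial (Fin (r + 1 + 1)) K := fun b' => ProjectiveSpace.dehomogenize K
    (⟨r + 1 + b, by omega⟩ : Fin (r + 1 + 1 + 1))
    (X (⟨r + 1 + b', by omega⟩ : Fin (r + 1 + 1 + 1)) : MvPolynomial (Fin (r + 1 + 1 + 1)) K) with hg
  have hgb : g b = 1 := by
    simp only [hg]
    exact ProjectiveSpace.dehomogenize_X_self K _
  have hgb' : ∀ b', b' ≠ b → g b' = X (Fin.last (r + 1)) := by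
    intro b' hb'
    simp only [hg]
    rw [← succAbove_killed_last b b' (Ne.symm hb'), ProjectiveSpace.dehomogenize_X_succAbove]
  have hu : ∀ j : Fin (r + 1), ProjectiveSpace.dehomogenize K (⟨r + 1 + b, by omega⟩ : Fin (r + 1 + 1 + 1))
      (X (j.castSucc.castSucc) : MvPolynomial (Fin (r + 1 + 1 + 1)) K) = X (Fin.castSucc j) := by
    intro j
    rw [← succAbove_killed_castSucc b j, ProjectiveSpace.dehomogenize_X_succAbove]
  rw [dehomogenize_F K A C F hF]
  rw [Finset.sum_congr rfl fun j _ => by rw [hu j]]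
  have hpd : ∀ (j : Fin (r + 1)) (G : MvPolynomial (Fin 2) K), pderiv (Fin.castSucc j) (aeval g G) = 0 := by
    intro j G
    refine SubmaxLine.pderiv_aeval_eq_zero K _ g (fun b' => ?_) G
    by_cases hb' : b' = b
    · rw [hb', hgb]
      exact (pderiv (Fin.castSucc j)).map_one_eq_zero
    · rw [hgb' b' hb']
      exact pderiv_X_of_ne (fun h => by
        have := congrArg Fin.val h
        simp at this
        have := j.2
        omega)
  refine SubmaxLine.isRegularRing_quotient_linN K (fun j : Fin (r + 1) => Fin.castSucc j) (Fin.castSucc_injective _)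
    (fun j => aeval g (A j)) (aeval g C) (fun t t' => hpd t (A t')) (fun t => hpd t C) fun x hx => ?_
  have hv : (fun b' => aeval x (g b')) ≠ 0 := by
    intro h0
    have h1 := congrFun h0 b
    simp only [hgb, map_one, Pi.zero_apply] at h1
    exact one_ne_zero h1
  refine hnc _ hv ⟨fun j => ?_, ?_⟩
  · have h := hx.1 j
    rw [SubmaxLine.aeval_aeval_point] at h
    rw [← coe_aeval_eq_eval]; exact h
  · have h := hx.2
    rw [SubmaxLine.aeval_aeval_point] at h
    rw [← coe_aeval_eq_eval]; exact h

/-! ## On the centre: the strict transforms on the charts `c = x_i`, `i ≤ r` -/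

/-- On the chart `c = x_i`: `x_i ↦ 1`, `x_j ↦ y_l` with `l < r` (`j ≠ i`). [folklore] -/
theorem dehomogenize_surv_X_surv (i j : Fin (r + 1)) :
    ProjectiveSpace.dehomogenize K (i.castSucc.castSucc : Fin (r + 1 + 1 + 1))
        (X (j.castSucc.castSucc) : MvPolynomial (Fin (r + 1 + 1 + 1)) K) = 1 ∨
      ∃ l : Fin (r + 1 + 1), (l : ℕ) < r ∧ (i.castSucc.castSucc : Fin (r + 1 + 1 + 1)).succAbove l = j.castSucc.castSucc ∧
        ProjectiveSpace.dehomogenize K (i.castSucc.castSucc : Fin (r + 1 + 1 + 1))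
          (X (j.castSucc.castSucc) : MvPolynomial (Fin (r + 1 + 1 + 1)) K) = X l := by
  by_cases hji : j = i
  · left
    rw [hji]
    exact ProjectiveSpace.dehomogenize_X_self K _
  · right
    have hne : (j.castSucc.castSucc : Fin (r + 1 + 1 + 1)) ≠ i.castSucc.castSucc := fun h =>
      hji (Fin.castSucc_injective _ (Fin.castSucc_injective _ h))
    obtain ⟨l, hl⟩ := Fin.exists_succAbove_eq hne
    exact ⟨l, val_lt_of_succAbove_surv i j l hl, hl, by rw [← hl, ProjectiveSpace.dehomogenize_X_succAbove]⟩

/-- On the chart `c = x_i`: the killed `x_{r+1+b}` is `y_{r+b}`. [folklore] -/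
theorem dehomogenize_surv_X_killed (i : Fin (r + 1)) (b : Fin 2) :
    ProjectiveSpace.dehomogenize K (i.castSucc.castSucc : Fin (r + 1 + 1 + 1))
      (X (⟨r + 1 + b, by omega⟩ : Fin (r + 1 + 1 + 1)) : MvPolynomial (Fin (r + 1 + 1 + 1)) K) = X ⟨r + b, by omega⟩ := by
  rw [← succAbove_surv_cen i b, ProjectiveSpace.dehomogenize_X_succAbove]

/-- On the chart `c = x_i`: `x_i ↦ 1`. [folklore] -/
theorem dehomogenize_surv_X_self (i : Fin (r + 1)) :
    ProjectiveSpace.dehomogenize K (i.castSucc.castSucc : Fin (r + 1 + 1 + 1))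
      (X (i.castSucc.castSucc) : MvPolynomial (Fin (r + 1 + 1 + 1)) K) = 1 :=
  ProjectiveSpace.dehomogenize_X_self K _

/-- On the chart `c = x_i`: for `j ≠ i`, `x_j ↦ y_l` with `l < r` and `c.succAbove l = x_j`. [folklore] -/
theorem dehomogenize_surv_X_surv_of_ne (i j : Fin (r + 1)) (hji : j ≠ i) :
    ∃ l : Fin (r + 1 + 1), (l : ℕ) < r ∧ (i.castSucc.castSucc : Fin (r + 1 + 1 + 1)).succAbove l = j.castSucc.castSucc ∧
      ProjectiveSpace.dehomogenize K (i.castSucc.castSucc : Fin (r + 1 + 1 + 1))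
        (X (j.castSucc.castSucc) : MvPolynomial (Fin (r + 1 + 1 + 1)) K) = X l := by
  have hne : (j.castSucc.castSucc : Fin (r + 1 + 1 + 1)) ≠ i.castSucc.castSucc := fun h =>
    hji (Fin.castSucc_injective _ (Fin.castSucc_injective _ h))
  obtain ⟨l, hl⟩ := Fin.exists_succAbove_eq hne
  exact ⟨l, val_lt_of_succAbove_surv i j l hl, hl, by rw [← hl, ProjectiveSpace.dehomogenize_X_succAbove]⟩

/-- Factoring the exceptional variable out of the transformed equation. [folklore] -/
theorem sum_factor {R : Type*} [CommRing R] {ι : Type*} (s : Finset ι) (u a : ι → R) (x c : R) (n : ℕ) :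
    ∑ j ∈ s, u j * (x ^ n * a j) + x ^ (n + 1) * c = x ^ n * (∑ j ∈ s, u j * a j + x * c) := by
  rw [mul_add, Finset.mul_sum, pow_succ]
  congr 1
  · exact Finset.sum_congr rfl fun j _ => by ring
  · ring

include hA hC hF in
/-- **The strict transform on the chart `c = x_i`, exceptional variable `y_{r+a}`**: Hu's substitution along `{y_r, y_{r+1}}` gives
`F(x_i := 1) ↦ y_{r+a}^{d+1} · (Σ_j u_j · A_j(g′) + y_{r+a} · C(g′))` with `g′_a = 1`, `g′_b = y_{r+b}` (`b ≠ a`). [cite: Hu2025, §5 Prop. 5.3] -/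
theorem subst_dehomogenize_surv (i : Fin (r + 1)) (a : Fin 2) :
    coordBlowupSubst K {l : Fin (r + 1 + 1) | r ≤ (l : ℕ)} ⟨r + a, by omega⟩
        (ProjectiveSpace.dehomogenize K (i.castSucc.castSucc : Fin (r + 1 + 1 + 1)) F) =
      X ⟨r + a, by omega⟩ ^ (d + 1) *
        (∑ j : Fin (r + 1), ProjectiveSpace.dehomogenize K (i.castSucc.castSucc : Fin (r + 1 + 1 + 1))
              (X (j.castSucc.castSucc) : MvPolynomial (Fin (r + 1 + 1 + 1)) K) *
            aeval (fun b : Fin 2 => if b = a then (1 : MvPolynomial (Fin (r + 1 + 1)) K) else X ⟨r + b, by omega⟩) (A j) +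
          X ⟨r + a, by omega⟩ *
            aeval (fun b : Fin 2 => if b = a then (1 : MvPolynomial (Fin (r + 1 + 1)) K) else X ⟨r + b, by omega⟩) C) := by
  classical
  have hg : ∀ b : Fin 2, coordBlowupSubst K {l : Fin (r + 1 + 1) | r ≤ (l : ℕ)} ⟨r + a, by omega⟩
      (ProjectiveSpace.dehomogenize K (i.castSucc.castSucc : Fin (r + 1 + 1 + 1))
        (X (⟨r + 1 + b, by omega⟩ : Fin (r + 1 + 1 + 1)) : MvPolynomial (Fin (r + 1 + 1 + 1)) K)) =
      X ⟨r + a, by omega⟩ * (fun b : Fin 2 => if b = a then (1 : MvPolynomial (Fin (r + 1 + 1)) K) else X ⟨r + b, by omega⟩) b := by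
    intro b
    rw [dehomogenize_surv_X_killed]
    by_cases hb : b = a
    · subst hb
      simp only [if_true, mul_one]
      exact coordBlowupSubst_X_self K _ _
    · simp only [if_neg hb]
      refine coordBlowupSubst_X_of_mem_of_ne K _ _ (by simp) ?_
      intro h
      apply hb
      have := congrArg Fin.val h
      simp at this
      exact Fin.ext (by omega)
  have hu : ∀ j : Fin (r + 1), coordBlowupSubst K {l : Fin (r + 1 + 1) | r ≤ (l : ℕ)} ⟨r + a, by omega⟩
      (ProjectiveSpace.dehomogenize K (i.castSucc.castSucc : Fin (r + 1 + 1 + 1))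
        (X (j.castSucc.castSucc) : MvPolynomial (Fin (r + 1 + 1 + 1)) K)) =
      ProjectiveSpace.dehomogenize K (i.castSucc.castSucc : Fin (r + 1 + 1 + 1))
        (X (j.castSucc.castSucc) : MvPolynomial (Fin (r + 1 + 1 + 1)) K) := by
    intro j
    rcases dehomogenize_surv_X_surv K i j with h1 | ⟨l, hl, -, hX⟩
    · rw [h1, map_one]
    · rw [hX]
      exact coordBlowupSubst_X_of_not_mem K _ _ (by simp; omega)
  have hC' := subst_aevalN K _ _ _ _ _ hg C hC
  have hA' := fun j => subst_aevalN K _ _ _ _ _ hg (A j) (hA j)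
  rw [dehomogenize_F K A C F hF, map_add, map_sum, hC']
  rw [Finset.sum_congr rfl fun j _ => by rw [map_mul, hu j, hA' j]]
  exact sum_factor _ _ _ _ _ _

end Family

end SubmaxLinN

end Summit.ResolutionOfSingularities.ResolutionOfSingularities.Cruxes.EquisingularLiftNat.Sections

end
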